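import Summits.QuantumFields.YangMills.Theorems.LangevinControlUVOSLegsAtWeakCouplingCStubLocalitySector
import Summits.QuantumFields.YangMills.Theorems.LangevinControlUVOSLegsAtWeakCouplingCStubLocalityChamber
import Summits.QuantumFields.YangMills.Theorems.LangevinControlUVOSLegsAtWeakCouplingCStubLocalityIdentity
import Mathlib.Data.Fin.Tuple.Sort
import HarnessLib

/-!
# Local bump invariance near a generic configuration from germ invariance (E1-locality — file D2)

Helper file for stub `stub_locality` of crux `OSLegsAtWeakCouplingC` (stmt-QuantumFields-16207, line `Sketch`,
continuation lead c2): `local_bumpInvariance`, the hypothesis `hloc` of the landed reduction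
`invariant_of_local_bumpInvariance` (…StubLocalityReduction).

Given a linear isometry `R` fixing the one-field family `S₁` on the germ (off-diagonal test functions supported in
configurations of diameter `< r₀`) and a configuration `c` of `q + 2` points whose coordinates are pairwise distinct
along every axis for `c` and for `R ∘ c`, sort the points along each axis (`Tuple.sort`: orderings `σ` for `c`, `σ'`
for `R ∘ c`); on the convex CHAMBER `C` of coordinate arrays whose gaps along `σ`, and whose image's gaps along `σ'`,
exceed a base gap `ε`, the defect `𝒰(R ∘ w) − 𝒰(w)` of the product-bump function is the restriction to real points
of `Φ = G' ∘ gaps' ∘ R_ℂ − G ∘ gaps` with `G, G'` the holomorphic extensions of file C2 (`defect_ofReal`, through the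
telescoping identity `conf_gapsOf` and translation invariance); `C` contains the small scaled copies `λ₀ c`, near
which the defect vanishes by germ invariance (product bumps of small diameter), so the identity theorem
`eqOn_convex_of_eqOn_ball` (…StubLocalityIdentity) makes it vanish on all of `C`, in particular at every `c'` near
`c`.  The base gap `ε`, the scale `λ₀` and the admissible profile radius `ε₀ = ε/4` are explicit in the smallest gap
`m₀` of `c`, its size `D₀ = Σ‖cᵢ‖` and `r₀`.
-/

set_option autoImplicit false

noncomputable section

namespace Summit.QuantumFields.YangMills.Theorems.OSLegsAtWeakCouplingC.Loc

open scoped BigOperators ComplexConjugate SchwartzMap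
open Filter Topology
open Literature.MathematicalPhysics.QuantumLattice Literature.MathematicalPhysics.AQFT
open Literature.Analysis.Complex (sectorRegion)
open Summit.QuantumFields.YangMills.Cruxes.OSLegsFromFemtoAndGap.DlrCollarTransfer (RPPos)
open Summit.QuantumFields.YangMills.Cruxes.OSLegsAtWeakCouplingC.Sketch
  (OffDiagDensity Separated IsSignedPerm Invariant GermInvariant SmallDiam)

variable {q : ℕ}

/-! ### Small geometric lemmas -/

/-- A coordinate is bounded by the Euclidean norm. -/
theorem abs_apply_le_norm' (x : EuclideanSpace ℝ (Fin 4)) (μ : Fin 4) : |x μ| ≤ ‖x‖ := by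
  rw [EuclideanSpace.norm_eq, ← Real.sqrt_sq_eq_abs]
  refine Real.sqrt_le_sqrt ?_
  have := Finset.single_le_sum (f := fun k : Fin 4 => ‖x k‖ ^ 2) (fun k _ => sq_nonneg _) (Finset.mem_univ μ)
  simpa using this

/-- Gaps of a scaled coordinate array. -/
theorem gapsOf_smul (σ : Fin 4 → Equiv.Perm (Fin (q + 2))) (ε t : ℝ) (w : Fin (q + 2) → Fin 4 → ℝ)
    (j : Fin (4 * q + 3 + 1)) : gapsOf σ ε (t • w) j = t * gapsOf σ 0 w j - ε := by
  simp only [gapsOf, Pi.smul_apply, smul_eq_mul]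
  ring

/-- **Gaps move by at most twice the coordinate displacement.** -/
theorem gapsOf_sub_le (σ : Fin 4 → Equiv.Perm (Fin (q + 2))) (ε : ℝ) {w v : Fin (q + 2) → Fin 4 → ℝ} {t : ℝ}
    (h : ∀ i μ, |w i μ - v i μ| ≤ t) (j : Fin (4 * q + 3 + 1)) : gapsOf σ ε v j - 2 * t ≤ gapsOf σ ε w j := by
  simp only [gapsOf]
  have h1 := h (σ (gapEquiv q j).1 (gapEquiv q j).2.succ) (gapEquiv q j).1
  have h2 := h (σ (gapEquiv q j).1 (Fin.castSucc (gapEquiv q j).2)) (gapEquiv q j).1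
  rw [abs_le] at h1 h2
  linarith

/-- The image array `(R (toE w i))_{i,μ}` is affine in `w`. -/
theorem rotArray_add_smul (R : EuclideanSpace ℝ (Fin 4) ≃ₗᵢ[ℝ] EuclideanSpace ℝ (Fin 4)) (a b : ℝ)
    (w w' : Fin (q + 2) → Fin 4 → ℝ) :
    (fun i μ => R (toE (a • w + b • w') i) μ) = a • (fun i μ => R (toE w i) μ) + b • (fun i μ => R (toE w' i) μ) := by
  funext i μ
  rw [toE_add_smul, map_add, map_smul, map_smul]
  simp

/-- Coordinates of the image array move by at most twice the coordinate displacement (`R` is an isometry). -/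
theorem abs_rotArray_sub_le (R : EuclideanSpace ℝ (Fin 4) ≃ₗᵢ[ℝ] EuclideanSpace ℝ (Fin 4))
    {w v : Fin (q + 2) → Fin 4 → ℝ} {t : ℝ} (ht : 0 ≤ t) (h : ∀ i μ, |w i μ - v i μ| ≤ t) (i : Fin (q + 2)) (μ : Fin 4) :
    |R (toE w i) μ - R (toE v i) μ| ≤ 2 * t := by
  rw [← PiLp.sub_apply, ← map_sub]
  refine (abs_apply_le_norm' _ μ).trans ?_
  rw [LinearIsometryEquiv.norm_map]
  exact norm_le_two_mul ht fun μ => by simpa [toE] using h i μ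

/-- The image array of a scaled array. -/
theorem rotArray_smul (R : EuclideanSpace ℝ (Fin 4) ≃ₗᵢ[ℝ] EuclideanSpace ℝ (Fin 4)) (t : ℝ)
    (w : Fin (q + 2) → Fin 4 → ℝ) : (fun i μ => R (toE (t • w) i) μ) = t • (fun i μ => R (toE w i) μ) := by
  have h := rotArray_add_smul R t 0 w w
  simp only [zero_smul, add_zero] at h
  exact h

variable {S₁ : SchwingerFamily (EuclideanSpace ℝ (Fin 4))}

/-- **The defect function at real points of the chamber** is the difference of the product-bump function at the
rotated and the original configuration. -/
theorem defect_ofReal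
    {ρ : 𝓢(EuclideanSpace ℝ (Fin 4), ℂ)} {r ε : ℝ}
    (hρ : tsupport (ρ : EuclideanSpace ℝ (Fin 4) → ℂ) ⊆ Metric.closedBall 0 r) (hε : 0 ≤ ε) (hr : 2 * r < ε)
    (htrans : ∀ (n : ℕ) (t : EuclideanSpace ℝ (Fin 4)) (F : 𝓢((Fin n → EuclideanSpace ℝ (Fin 4)), ℂ)),
      IsOffDiagonal F → S₁ n (translateMulti t F) = S₁ n F)
    (R : EuclideanSpace ℝ (Fin 4) ≃ₗᵢ[ℝ] EuclideanSpace ℝ (Fin 4)) (σ σ' : Fin 4 → Equiv.Perm (Fin (q + 2)))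
    {G G' : (Fin (4 * q + 3 + 1) → ℂ) → ℂ}
    (hGS : ∀ u : Fin (4 * q + 3 + 1) → ℝ, (∀ j, 0 < u j) → G (fun j => (u j : ℂ)) = bumpFn ρ S₁ (q + 2) (conf ε σ u))
    (hG'S : ∀ u : Fin (4 * q + 3 + 1) → ℝ, (∀ j, 0 < u j) → G' (fun j => (u j : ℂ)) = bumpFn ρ S₁ (q + 2) (conf ε σ' u))
    {w : Fin (q + 2) → Fin 4 → ℝ} (hw : ∀ j, 0 < gapsOf σ ε w j) (hw' : ∀ j, 0 < gapsOf σ' ε (fun i μ => R (toE w i) μ) j) :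
    G' (gapsOfC σ' ε (rotC R fun i μ => ((w i μ : ℝ) : ℂ))) - G (gapsOfC σ ε fun i μ => ((w i μ : ℝ) : ℂ)) =
      bumpFn ρ S₁ (q + 2) (fun i => R (toE w i)) - bumpFn ρ S₁ (q + 2) (toE w) := by
  rw [rotC_ofReal, gapsOfC_ofReal, gapsOfC_ofReal, hGS _ hw, hG'S _ hw']
  have h1 : conf ε σ (gapsOf σ ε w) = fun i => toE w i + (-WithLp.toLp 2 (fun μ => w (σ μ 0) μ)) := by
    funext i; rw [conf_gapsOf, sub_eq_add_neg]
  have h2 : conf ε σ' (gapsOf σ' ε (fun i μ => R (toE w i) μ)) =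
      fun i => R (toE w i) + (-WithLp.toLp 2 (fun μ => R (toE w (σ' μ 0)) μ)) := by
    funext i; rw [conf_gapsOf, sub_eq_add_neg]; rfl
  have hsep : SepCenters r (toE w) := sepCenters_toE_of_gapsOf_nonneg σ hε hr fun j => (hw j).le
  have hsep' : SepCenters r (fun i => R (toE w i)) := by
    have h := sepCenters_toE_of_gapsOf_nonneg σ' hε hr fun j => (hw' j).le
    simpa [toE] using h
  rw [h1, h2, bumpFn_add_const hρ htrans hsep, bumpFn_add_const hρ htrans hsep']

/-- **Local bump invariance near a generic configuration from germ invariance.**  For a one-field family with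
translation invariance on `⁰𝒮`, E3, `RPPos`, signed-permutation invariance and bounded densities off the diagonal,
a linear isometry `R` fixing the family on the germ of diameter `r₀`, and a configuration `c` of `q + 2` points
whose coordinates are pairwise distinct along every axis for `c` and for `R ∘ c`: there are a neighbourhood `V`
of `c` and `ε₀ > 0` such that for every radial real profile of support radius `< ε₀` the product-bump function
takes the same value at `c'` and at `R ∘ c'`, for all `c' ∈ V`.  Mechanism: the holomorphic extensions of file
C2 for the orderings of `c` and of `R ∘ c`, the convex chamber of these orderings (which contains the small
scaled copies `λ c` where germ invariance applies), and the identity theorem `eqOn_convex_of_eqOn_ball`. -/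
theorem local_bumpInvariance
    (htrans : ∀ (n : ℕ) (t : EuclideanSpace ℝ (Fin 4)) (F : 𝓢((Fin n → EuclideanSpace ℝ (Fin 4)), ℂ)),
      IsOffDiagonal F → S₁ n (translateMulti t F) = S₁ n F)
    (hE3 : S₁.toLabelled.IsSymmetric) (hRP : RPPos S₁)
    (hsigned : ∀ R : EuclideanSpace ℝ (Fin 4) ≃ₗᵢ[ℝ] EuclideanSpace ℝ (Fin 4), IsSignedPerm R → Invariant S₁ R)
    (hdens : OffDiagDensity S₁)
    (R : EuclideanSpace ℝ (Fin 4) ≃ₗᵢ[ℝ] EuclideanSpace ℝ (Fin 4)) {r₀ : ℝ} (hr₀ : 0 < r₀) (hgerm : GermInvariant S₁ R r₀)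
    (c : Fin (q + 2) → EuclideanSpace ℝ (Fin 4))
    (hc : c ∉ {c : Fin (q + 2) → EuclideanSpace ℝ (Fin 4) | ∃ i j : Fin (q + 2), i ≠ j ∧ ∃ μ : Fin 4, c i μ = c j μ ∨ R (c i) μ = R (c j) μ}) :
    ∃ V ∈ 𝓝 c, ∃ ε₀ : ℝ, 0 < ε₀ ∧ ∀ (ρ : 𝓢(EuclideanSpace ℝ (Fin 4), ℂ)) (r : ℝ),
      tsupport (ρ : EuclideanSpace ℝ (Fin 4) → ℂ) ⊆ Metric.closedBall 0 r → 0 ≤ r → r < ε₀ →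
      (∀ (P : EuclideanSpace ℝ (Fin 4) ≃ₗᵢ[ℝ] EuclideanSpace ℝ (Fin 4)) (x : EuclideanSpace ℝ (Fin 4)), ρ (P x) = ρ x) →
      (∀ x, (starRingEnd ℂ) (ρ x) = ρ x) →
      ∀ c' ∈ V, S₁ (q + 2) (prodBumps ρ (q + 2) (fun i => R (c' i))) = S₁ (q + 2) (prodBumps ρ (q + 2) c') := by
  classical
  -- genericity: distinct coordinates along every axis
  simp only [Set.mem_setOf_eq, not_exists, not_and, not_or] at hc
  have hinj : ∀ μ, Function.Injective fun i => c i μ := fun μ i j h => by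
    by_contra hij; exact (hc i j hij μ).1 h
  have hinj' : ∀ μ, Function.Injective fun i => R (c i) μ := fun μ i j h => by
    by_contra hij; exact (hc i j hij μ).2 h
  -- the orderings
  set σ : Fin 4 → Equiv.Perm (Fin (q + 2)) := fun μ => Tuple.sort fun i => c i μ with hσ
  set σ' : Fin 4 → Equiv.Perm (Fin (q + 2)) := fun μ => Tuple.sort fun i => R (c i) μ with hσ'
  have hsm : ∀ μ, StrictMono ((fun i => c i μ) ∘ σ μ) := fun μ =>
    (Tuple.monotone_sort _).strictMono_of_injective ((hinj μ).comp (σ μ).injective)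
  have hsm' : ∀ μ, StrictMono ((fun i => R (c i) μ) ∘ σ' μ) := fun μ =>
    (Tuple.monotone_sort _).strictMono_of_injective ((hinj' μ).comp (σ' μ).injective)
  -- the coordinate arrays and their positive gaps
  set cc : Fin (q + 2) → Fin 4 → ℝ := fun i μ => c i μ with hcc
  set rc : Fin (q + 2) → Fin 4 → ℝ := fun i μ => R (c i) μ with hrc
  have hg0 : ∀ j, 0 < gapsOf σ 0 cc j := by
    intro j
    simp only [gapsOf, sub_zero, hcc]
    have := hsm (gapEquiv q j).1 (Fin.castSucc_lt_succ (i := (gapEquiv q j).2))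
    simp only [Function.comp_apply] at this
    linarith
  have hg0' : ∀ j, 0 < gapsOf σ' 0 rc j := by
    intro j
    simp only [gapsOf, sub_zero, hrc]
    have := hsm' (gapEquiv q j).1 (Fin.castSucc_lt_succ (i := (gapEquiv q j).2))
    simp only [Function.comp_apply] at this
    linarith
  -- the smallest gap
  set m₀ : ℝ := Finset.univ.inf' Finset.univ_nonempty (fun j => min (gapsOf σ 0 cc j) (gapsOf σ' 0 rc j)) with hm₀
  have hm₀pos : 0 < m₀ := by
    rw [hm₀, Finset.lt_inf'_iff]
    exact fun j _ => lt_min (hg0 j) (hg0' j)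
  have hm₀le : ∀ j, m₀ ≤ gapsOf σ 0 cc j ∧ m₀ ≤ gapsOf σ' 0 rc j := fun j =>
    ⟨(Finset.inf'_le _ (Finset.mem_univ j)).trans (min_le_left _ _),
     (Finset.inf'_le _ (Finset.mem_univ j)).trans (min_le_right _ _)⟩
  -- the size of the configuration and the scale
  set D₀ : ℝ := ∑ i, ‖c i‖ with hD₀
  have hD₀0 : 0 ≤ D₀ := Finset.sum_nonneg fun i _ => norm_nonneg _
  have hD₀le : ∀ i, ‖c i‖ ≤ D₀ := fun i => Finset.single_le_sum (f := fun i => ‖c i‖) (fun i _ => norm_nonneg _) (Finset.mem_univ i)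
  set l₀ : ℝ := min 1 (r₀ / (16 * (D₀ + 1))) with hl₀
  have hl₀pos : 0 < l₀ := lt_min one_pos (by positivity)
  have hl₀1 : l₀ ≤ 1 := min_le_left _ _
  have hl₀D : l₀ * D₀ ≤ r₀ / 16 := by
    have h1 : l₀ ≤ r₀ / (16 * (D₀ + 1)) := min_le_right _ _
    calc l₀ * D₀ ≤ r₀ / (16 * (D₀ + 1)) * D₀ := mul_le_mul_of_nonneg_right h1 hD₀0
      _ ≤ r₀ / (16 * (D₀ + 1)) * (D₀ + 1) := mul_le_mul_of_nonneg_left (by linarith) (by positivity)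
      _ = r₀ / 16 := by field_simp
  -- the base gap and the support bound
  set ε : ℝ := min (l₀ * m₀ / 4) (r₀ / 16) with hεdef
  have hεpos : 0 < ε := lt_min (by positivity) (by positivity)
  have hε0 : 0 ≤ ε := hεpos.le
  have hε1 : ε ≤ l₀ * m₀ / 4 := min_le_left _ _
  have hε2 : ε ≤ r₀ / 16 := min_le_right _ _
  have hε4 : 4 * ε ≤ l₀ * m₀ := by linarith
  have hm₀4 : 4 * ε ≤ m₀ := hε4.trans (by nlinarith)
  -- the neighbourhood and the answer
  refine ⟨Metric.ball c (ε / 4), Metric.ball_mem_nhds c (by positivity), ε / 4, by positivity, ?_⟩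
  intro ρ r hρ hr0 hr hρP hρre c' hc'
  have h4r : 4 * r < ε := by linarith
  have h2r : 2 * r < ε := by linarith
  -- the two holomorphic extensions
  obtain ⟨G, hG, hGS⟩ := exists_holomorphic_extension_bumpFn htrans hE3 hRP hsigned hdens hρ hr0 h4r hρP hρre σ
  obtain ⟨G', hG', hG'S⟩ := exists_holomorphic_extension_bumpFn htrans hE3 hRP hsigned hdens hρ hr0 h4r hρP hρre σ'
  -- the defect function, its domain of holomorphy, the chamber
  set Φ : (Fin (q + 2) → Fin 4 → ℂ) → ℂ := fun w => G' (gapsOfC σ' ε (rotC R w)) - G (gapsOfC σ ε w) with hΦ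
  set VC : Set (Fin (q + 2) → Fin 4 → ℂ) :=
    {w | gapsOfC σ ε w ∈ sectorRegion (4 * q + 3) (Real.pi / 2)} ∩
      {w | gapsOfC σ' ε (rotC R w) ∈ sectorRegion (4 * q + 3) (Real.pi / 2)} with hVC
  have hVo : IsOpen VC :=
    ((isOpen_sectorRegion _ _).preimage (continuous_gapsOfC σ ε)).inter
      ((isOpen_sectorRegion _ _).preimage ((continuous_gapsOfC σ' ε).comp (differentiable_rotC R).continuous))
  have hΦd : DifferentiableOn ℂ Φ VC := by
    refine DifferentiableOn.sub ?_ ?_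
    · exact hG'.comp (((differentiable_gapsOfC σ' ε).comp (differentiable_rotC R)).differentiableOn) fun w hw => hw.2
    · exact hG.comp (differentiable_gapsOfC σ ε).differentiableOn fun w hw => hw.1
  set C : Set (Fin (q + 2) → Fin 4 → ℝ) :=
    {w | (∀ j, 0 < gapsOf σ ε w j) ∧ (∀ j, 0 < gapsOf σ' ε (fun i μ => R (toE w i) μ) j)} with hCdef
  have hpos : ∀ {a b x y : ℝ}, 0 ≤ a → 0 ≤ b → a + b = 1 → 0 < x → 0 < y → 0 < a * x + b * y := by
    intro a b x y ha hb hab hx hy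
    calc (0 : ℝ) < min x y := lt_min hx hy
      _ = a * min x y + b * min x y := by rw [← add_mul, hab, one_mul]
      _ ≤ a * x + b * y := add_le_add (mul_le_mul_of_nonneg_left (min_le_left _ _) ha)
          (mul_le_mul_of_nonneg_left (min_le_right _ _) hb)
  have hCconv : Convex ℝ C := by
    intro w hw w' hw' a b ha hb hab
    refine ⟨fun j => ?_, fun j => ?_⟩
    · rw [gapsOf_add_smul σ ε hab]; exact hpos ha hb hab (hw.1 j) (hw'.1 j)
    · rw [rotArray_add_smul, gapsOf_add_smul σ' ε hab]; exact hpos ha hb hab (hw.2 j) (hw'.2 j)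
  have hCV : ∀ w ∈ C, (fun i μ => ((w i μ : ℝ) : ℂ)) ∈ VC := by
    intro w hw
    refine ⟨?_, ?_⟩
    · simp only [Set.mem_setOf_eq]
      rw [gapsOfC_ofReal]; exact ofReal_mem_sectorRegion (by positivity) hw.1
    · simp only [Set.mem_setOf_eq]
      rw [rotC_ofReal, gapsOfC_ofReal]; exact ofReal_mem_sectorRegion (by positivity) hw.2
  -- the real ball about the scaled configuration
  set x₀ : Fin (q + 2) → Fin 4 → ℝ := l₀ • cc with hx₀
  have hnear : ∀ {w : Fin (q + 2) → Fin 4 → ℝ} {t : ℝ}, (∀ i μ, |w i μ - x₀ i μ| ≤ t) → 0 ≤ t →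
      (∀ j, l₀ * m₀ - ε - 2 * t ≤ gapsOf σ ε w j) ∧
      (∀ j, l₀ * m₀ - ε - 4 * t ≤ gapsOf σ' ε (fun i μ => R (toE w i) μ) j) := by
    intro w t h ht
    refine ⟨fun j => ?_, fun j => ?_⟩
    · have h1 := gapsOf_sub_le σ ε h j
      rw [hx₀, gapsOf_smul] at h1
      have h2 := (hm₀le j).1
      nlinarith
    · have h' : ∀ i μ, |R (toE w i) μ - R (toE x₀ i) μ| ≤ 2 * t := abs_rotArray_sub_le R ht h
      have h1 := gapsOf_sub_le σ' ε h' j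
      have hx : (fun i μ => R (toE x₀ i) μ) = l₀ • rc := by
        rw [hx₀, rotArray_smul]
        rfl
      rw [hx, gapsOf_smul] at h1
      have h2 := (hm₀le j).2
      nlinarith
  have hball : ∀ w ∈ Metric.ball x₀ (ε / 2), ∀ i μ, |w i μ - x₀ i μ| ≤ ε / 2 := by
    intro w hw i μ
    have h1 : dist w x₀ < ε / 2 := hw
    have h2 : dist (w i) (x₀ i) ≤ dist w x₀ := dist_le_pi_dist w x₀ i
    have h3 : dist (w i μ) (x₀ i μ) ≤ dist (w i) (x₀ i) := dist_le_pi_dist (w i) (x₀ i) μ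
    rw [Real.dist_eq] at h3
    linarith
  have hx₀C : Metric.ball x₀ (ε / 2) ⊆ C := by
    intro w hw
    obtain ⟨h1, h2⟩ := hnear (hball w hw) (by positivity)
    exact ⟨fun j => by linarith [h1 j], fun j => by linarith [h2 j]⟩
  -- germ invariance on the ball
  have hzero : ∀ w ∈ Metric.ball x₀ (ε / 2), Φ (fun i μ => ((w i μ : ℝ) : ℂ)) = 0 := by
    intro w hw
    have hwC := hx₀C hw
    show G' (gapsOfC σ' ε (rotC R fun i μ => ((w i μ : ℝ) : ℂ))) - G (gapsOfC σ ε fun i μ => ((w i μ : ℝ) : ℂ)) = 0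
    rw [defect_ofReal hρ hε0 h2r htrans R σ σ' hGS hG'S hwC.1 hwC.2, sub_eq_zero, bumpFn, bumpFn,
      ← linActMulti_prodBumps ρ R (fun x => hρP _ x)]
    have hsep : SepCenters r (toE w) := sepCenters_toE_of_gapsOf_nonneg σ hε0 h2r fun j => (hwC.1 j).le
    refine hgerm _ _ (isOffDiagonal_prodBumps ρ hρ hsep) fun x hx i i' => ?_
    -- the support has small diameter
    have hsup := tsupport_prodBumps_subset ρ hρ (toE w) hx
    have hwi : ∀ i, ‖toE w i‖ ≤ ε + r₀ / 16 := by
      intro i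
      have hb := hball w hw
      have h1 : ‖toE w i - l₀ • c i‖ ≤ 2 * (ε / 2) :=
        norm_le_two_mul (by positivity) fun μ => by simpa [toE, hx₀, hcc] using hb i μ
      have h2 : ‖l₀ • c i‖ ≤ r₀ / 16 := by
        rw [norm_smul, Real.norm_eq_abs, abs_of_pos hl₀pos]
        exact (mul_le_mul_of_nonneg_left (hD₀le i) hl₀pos.le).trans hl₀D
      calc ‖toE w i‖ = ‖(toE w i - l₀ • c i) + l₀ • c i‖ := by rw [sub_add_cancel]
        _ ≤ ‖toE w i - l₀ • c i‖ + ‖l₀ • c i‖ := norm_add_le _ _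
        _ ≤ ε + r₀ / 16 := by linarith
    have hi := Metric.mem_closedBall.1 (hsup i)
    have hi' := Metric.mem_closedBall.1 (hsup i')
    calc dist (x i) (x i') ≤ dist (x i) (toE w i) + dist (toE w i) (toE w i') + dist (toE w i') (x i') :=
          dist_triangle4 _ _ _ _
      _ ≤ r + (‖toE w i‖ + ‖toE w i'‖) + r := by
          rw [dist_comm (toE w i') (x i')]
          exact add_le_add (add_le_add hi (dist_le_norm_add_norm _ _)) hi'
      _ < r₀ := by have := hwi i; have := hwi i'; linarith
  -- the identity theorem on the chamber, at the configuration `c'`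
  have hmain := eqOn_convex_of_eqOn_ball hVo hΦd hCconv hCV (half_pos hεpos) hx₀C hzero
  set cc' : Fin (q + 2) → Fin 4 → ℝ := fun i μ => c' i μ with hcc'
  have hc'C : cc' ∈ C := by
    have hd : ∀ i μ, |cc' i μ - cc i μ| ≤ ε / 4 := fun i μ => by
      have h1 : dist (c' i) (c i) < ε / 4 := (dist_le_pi_dist c' c i).trans_lt hc'
      rw [dist_eq_norm] at h1
      exact ((abs_apply_le_norm' (c' i - c i) μ).trans h1.le).trans_eq' (by simp [hcc', hcc])
    refine ⟨fun j => ?_, fun j => ?_⟩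
    · have h1 := gapsOf_sub_le σ ε hd j
      have h2 : gapsOf σ ε cc j = gapsOf σ 0 cc j - ε := by simp only [gapsOf, sub_zero]
      have h3 := (hm₀le j).1
      linarith
    · have hd' := abs_rotArray_sub_le R (by positivity) hd
      have h1 := gapsOf_sub_le σ' ε hd' j
      have h2 : gapsOf σ' ε (fun i μ => R (toE cc i) μ) j = gapsOf σ' 0 rc j - ε := by
        simp only [gapsOf, sub_zero, hrc, hcc, toE_coords]
      have h3 := (hm₀le j).2
      linarith
  have h := hmain cc' hc'C
  change G' (gapsOfC σ' ε (rotC R fun i μ => ((cc' i μ : ℝ) : ℂ))) - G (gapsOfC σ ε fun i μ => ((cc' i μ : ℝ) : ℂ)) = 0 at h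
  rw [defect_ofReal hρ hε0 h2r htrans R σ σ' hGS hG'S hc'C.1 hc'C.2, sub_eq_zero] at h
  simpa [bumpFn, hcc', toE_coords] using h

end Summit.QuantumFields.YangMills.Theorems.OSLegsAtWeakCouplingC.Loc

end
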